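import Literature.AlgebraicGeometry.AbelianSchemes.AbelianSchemeOverBase
import Literature.AlgebraicGeometry.AbelianSchemes.AbelianSchemeOverField
import Literature.AlgebraicGeometry.Motives.AlgPointsSeparate
import HarnessLib

/-!
# Abelian schemes with reduced self-product (over a base of finite type over a field) are COMMUTATIVE group schemes
# — [MumfordFogartyKirwan1994, Ch. 6 §1, Cor. 6.5] without the rigidity lemma

[MumfordFogartyKirwan1994, Ch. 6 §1, Cor. 6.5 (p. 117)]: «If `X` is an abelian scheme over a scheme `S`, then `X` is a
commutative group scheme» — in print a corollary of the RIGIDITY LEMMA Prop. 6.1 (connected base, Artin-ring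
thickenings, `p_* 𝒪_X = 𝒪_S`), which neither Mathlib nor the tree has over a base.  Over a FIELD the tree has it
(`Motives.AbelianVariety.instIsCommMonObj` = Mathlib `isCommMonObj_of_isProper_of_geometricallyIntegral`, Stacks 0BFD).

THIS FILE proves the case the cell's rung-0 programme needs (the universal abelian scheme over Mumford's SMOOTH moduli
scheme `𝒜_{g,δ,N} ⊗ ℚ`; M1PRIME-DAG P32/P33): if `S` is locally of finite type and separated over a field `K` and the
total space of `X ×_S X` is REDUCED, then `X/S` is commutative (`isCommMonObj_of_isReduced`); in particular whenever
`S` is smooth and separated over `K` (`isCommMonObj_of_smooth`).  ARGUMENT: the two laws `μ` and `μ ∘ swap :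
X ×_S X → X` are `K`-morphisms from a reduced `K`-scheme locally of finite type into a `K`-scheme separated over `K`;
they agree on every `Ω`-valued point for `Ω = K̄` — such a point lies in ONE fibre `X_s`, an abelian variety over `Ω`,
where the law is commutative (`FibrePoints.mul_comm`, through the cartesian-monoidal base change `Over.pullback s`,
Mathlib `Functor.map_mul`, and the injectivity of `f ↦ f ×_S Spec Ω` on fibre points via the diagonal section) — and
`Ω`-points separate such morphisms (`Motives.ext_of_forall_point_eq`, Mumford AV §4 / Görtz–Wedhorn I Prop. 9.2).  The
smooth corollary gets reducedness of `X ×_S X` from `Resolution.isReduced_of_smooth`.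

Theorems only; NO instance is declared (consumers take `haveI := A.isCommMonObj_of_smooth pS`).  Cell hodgecm-mathlib,
seat B-p11; `B-plan/M1PRIME-DAG.md` P33.  HC_CM is proved only modulo the 7 printed citations until rung 0 closes; this
file discharges none of them.

## References
* [MumfordFogartyKirwan1994] D. Mumford, J. Fogarty, F. Kirwan, *Geometric Invariant Theory*, 3rd ed. (1994), Ch. 6 §1:
  Def. 6.1 (p. 115), Prop. 6.1 (Rigidity lemma, pp. 115–116), Cor. 6.4–6.6 (p. 117) (held copy
  `book:mumford1994-geometric-invariant-theory`, chunks p0120–p0122).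
* [MumfordAV1970] D. Mumford, *Abelian Varieties*, §4 (rigidity; morphisms determined by points).
* [GortzWedhorn2020] U. Görtz, T. Wedhorn, *Algebraic Geometry I*, 2nd ed., Section (4.7) with (4.7.1) (base change and
  points), Prop. 9.2.
-/

noncomputable section

universe u

open CategoryTheory CategoryTheory.Limits AlgebraicGeometry MonoidalCategory CartesianMonoidalCategory
open scoped MonObj CategoryTheory.Obj

namespace Literature.AlgebraicGeometry.AbelianSchemes

namespace AbelianSchemeOver

variable {S : Scheme.{u}} (A : AbelianSchemeOver S) {Ω : Type u} [Field Ω] (s : Spec (.of Ω) ⟶ S)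

/-! ### §1 The fibre over a field-valued point is a commutative group scheme; fibre points commute -/

/-- **The fibre `A_s` of an abelian scheme over a field-valued point is a COMMUTATIVE group scheme** — it is an abelian
variety over `Ω` (`AbelianScheme.toAbelianVariety`), and abelian varieties are commutative
(`Motives.AbelianVariety.instIsCommMonObj`, Mathlib `isCommMonObj_of_isProper_of_geometricallyIntegral`).  Stated for the
base change `(Over.pullback s).obj A.X` with its transported group law (= `(A.fibre s).X`, `fibre_X`), the form
`Functor.map_mul` speaks.  A theorem, not an instance: invoke with `haveI`.
[cite: MumfordFogartyKirwan1994, Ch. 6 §1 Corollary 6.5 (p. 117)] -/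
theorem isCommMonObj_pullback_obj : IsCommMonObj ((Over.pullback s).obj A.X) :=
  Literature.AlgebraicGeometry.Motives.AbelianVariety.instIsCommMonObj (A.fibre s).toAbelianVariety
/-- **Base change to the fibre is injective on fibre points**: an `S`-morphism `f : Spec Ω → X` over `s` is recovered
from `f ×_S Spec Ω : Spec Ω ×_S Spec Ω → X ×_S Spec Ω` by composing with the diagonal section and the first
projection — the bijection `Hom_S(T, X) ≅ Hom_{S′}(T, X_{(S′)})` of [GortzWedhorn2020] (4.7.1) at `T = S′ = Spec Ω`.
[cite: GortzWedhorn2020, Section (4.7), (4.7.1) (p. 135)] -/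
theorem FibrePoints.left_eq_of_pullback_map (f : A.FibrePoints s) :
    f.left = pullback.lift (f := (Over.mk s).hom) (g := s) (𝟙 _) (𝟙 _) rfl ≫
      ((Over.pullback s).map f).left ≫ pullback.fst A.X.hom s := by
  have hc : ((Over.pullback s).map f).left ≫ pullback.fst A.X.hom s = pullback.fst (Over.mk s).hom s ≫ f.left := by
    simp only [Over.pullback_map_left]
    erw [pullback.lift_fst]
  erw [hc, ← Category.assoc, pullback.lift_fst]
  exact (Category.id_comp _).symm

/-- Two fibre points with the same base change to the fibre are equal (injectivity in [GortzWedhorn2020] (4.7.1):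
`Hom_{S′}(T, X_{(S′)}) ≅ Hom_S(T, X)`). [cite: GortzWedhorn2020, Section (4.7), (4.7.1) (p. 135)] -/
theorem FibrePoints.eq_of_pullback_map_eq {f₁ f₂ : A.FibrePoints s}
    (h : (Over.pullback s).map f₁ = (Over.pullback s).map f₂) : f₁ = f₂ := by
  ext : 1
  rw [FibrePoints.left_eq_of_pullback_map A s f₁, FibrePoints.left_eq_of_pullback_map A s f₂, h]

/-- **Fibre points commute**: the group `X_s(Ω) = (Spec Ω →_S X over s)` of a fibre of an abelian scheme is
commutative — WITHOUT any commutativity hypothesis on `X/S`: base-change the two products to the fibre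
(`Functor.map_mul` for the cartesian-monoidal `Over.pullback s`), commute there (`isCommMonObj_pullback_obj`), and
come back by `FibrePoints.eq_of_pullback_map_eq`. [cite: MumfordFogartyKirwan1994, Ch. 6 §1 Corollary 6.5 (p. 117)] -/
theorem FibrePoints.mul_comm (x y : A.FibrePoints s) : x * y = y * x := by
  haveI := A.isCommMonObj_pullback_obj s
  apply FibrePoints.eq_of_pullback_map_eq A s
  rw [Functor.map_mul, Functor.map_mul, _root_.mul_comm]

/-! ### §2 Commutativity of `X/S` from reducedness of `X ×_S X` -/

/-- An `Ω`-point `P` of `X ×_S X`, read as a fibre point of `X ⊗ X` over `s := P ≫ (X ⊗ X → S)`, has components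
`x, y ∈ X_s(Ω)`, and `P ≫ μ = (x · y)` on underlying morphisms (Mathlib `Hom.mul_def`, `lift_comp_fst_snd`) — the group
law on points, [MumfordAV1970] §4. [cite: MumfordAV1970, §4] -/
theorem comp_mul_left_eq (P : Spec (.of Ω) ⟶ (A.X ⊗ A.X).left) :
    P ≫ (μ[A.X]).left =
      ((Over.homMk (U := Over.mk (P ≫ (A.X ⊗ A.X).hom)) (V := A.X ⊗ A.X) P rfl ≫ fst A.X A.X) *
        (Over.homMk (U := Over.mk (P ≫ (A.X ⊗ A.X).hom)) (V := A.X ⊗ A.X) P rfl ≫ snd A.X A.X)).left := by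
  rw [Hom.mul_def, lift_comp_fst_snd, Over.comp_left]
  rfl

/-- Companion of `comp_mul_left_eq` for the swapped law: `P ≫ (swap ≫ μ) = (y · x)` ([MumfordAV1970] §4, group law on
points). [cite: MumfordAV1970, §4] -/
theorem comp_braiding_mul_left_eq (P : Spec (.of Ω) ⟶ (A.X ⊗ A.X).left) :
    P ≫ ((β_ A.X A.X).hom ≫ μ[A.X]).left =
      ((Over.homMk (U := Over.mk (P ≫ (A.X ⊗ A.X).hom)) (V := A.X ⊗ A.X) P rfl ≫ snd A.X A.X) *
        (Over.homMk (U := Over.mk (P ≫ (A.X ⊗ A.X).hom)) (V := A.X ⊗ A.X) P rfl ≫ fst A.X A.X)).left := by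
  have hb : Over.homMk (U := Over.mk (P ≫ (A.X ⊗ A.X).hom)) (V := A.X ⊗ A.X) P rfl ≫ (β_ A.X A.X).hom =
      lift (Over.homMk (U := Over.mk (P ≫ (A.X ⊗ A.X).hom)) (V := A.X ⊗ A.X) P rfl ≫ snd A.X A.X)
        (Over.homMk (U := Over.mk (P ≫ (A.X ⊗ A.X).hom)) (V := A.X ⊗ A.X) P rfl ≫ fst A.X A.X) := by
    apply CartesianMonoidalCategory.hom_ext
    · rw [Category.assoc, braiding_hom_fst, lift_fst]
    · rw [Category.assoc, braiding_hom_snd, lift_snd]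
  rw [Hom.mul_def, ← hb, Over.comp_left, Over.comp_left]
  rfl

/-- **COMMUTATIVITY FROM REDUCEDNESS** ([MumfordFogartyKirwan1994] Cor. 6.5 in the case the rung-0 programme uses):
let `S` be locally of finite type and separated over a field `K`, `X/S` an abelian scheme whose self-product `X ×_S X`
has REDUCED total space.  Then `X/S` is a commutative group scheme.  Proof: `μ` and `μ ∘ swap` are `K`-morphisms from
the reduced `K`-scheme of finite type `X ×_S X` to `X`, separated over `K`; they agree on every `K̄`-point by
`FibrePoints.mul_comm` (each point factors through one fibre, an abelian variety); ★
`Motives.ext_of_forall_point_eq` concludes.  A theorem, not an instance.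
[cite: MumfordFogartyKirwan1994, Ch. 6 §1 Corollary 6.5 (p. 117)] [cite: MumfordAV1970, §4] -/
theorem isCommMonObj_of_isReduced {K : Type u} [Field K] (pS : S ⟶ Spec (.of K))
    [LocallyOfFiniteType pS] [IsSeparated pS] [IsReduced (A.X ⊗ A.X).left] : IsCommMonObj A.X where
  mul_comm := by
    haveI := A.isProper
    haveI := A.isSmooth
    have hA : LocallyOfFiniteType A.X.hom := inferInstance
    have hAA : LocallyOfFiniteType (A.X ⊗ A.X).hom := by
      rw [Over.tensorObj_hom]
      exact MorphismProperty.comp_mem _ _ _ (MorphismProperty.pullback_fst _ _ hA) hA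
    haveI : LocallyOfFiniteType ((A.X ⊗ A.X).hom ≫ pS) := MorphismProperty.comp_mem _ _ _ hAA inferInstance
    haveI : IsSeparated (A.X.hom ≫ pS) := inferInstance
    ext : 1
    refine Literature.AlgebraicGeometry.Motives.ext_of_forall_point_eq ((A.X ⊗ A.X).hom ≫ pS) (A.X.hom ≫ pS)
      (AlgebraicClosure K) ?_ ?_ fun P _ => ?_
    · rw [← Category.assoc, Over.w]
    · rw [← Category.assoc, Over.w]
    · rw [A.comp_braiding_mul_left_eq, A.comp_mul_left_eq, FibrePoints.mul_comm]

/-- **COMMUTATIVITY OVER A SMOOTH BASE**: if `S` is smooth and separated over a field `K`, every abelian scheme over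
`S` is commutative — `X ×_S X → Spec K` is smooth (base change and composition), hence its total space is reduced
(★ `Resolution.isReduced_of_smooth`), and `isCommMonObj_of_isReduced` applies.  This is the case of Mumford's
universal family over `𝒜_{g,δ,N} ⊗ ℚ` (smooth over `ℚ`). [cite: MumfordFogartyKirwan1994, Ch. 6 §1 Corollary 6.5 (p. 117)] -/
theorem isCommMonObj_of_smooth {K : Type u} [Field K] (pS : S ⟶ Spec (.of K)) [Smooth pS] [IsSeparated pS] :
    IsCommMonObj A.X := by
  haveI := A.isSmooth
  have hAA : Smooth (A.X ⊗ A.X).hom := by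
    rw [Over.tensorObj_hom]
    exact MorphismProperty.comp_mem _ _ _ (MorphismProperty.pullback_fst _ _ A.isSmooth) A.isSmooth
  have hAAS : Smooth ((A.X ⊗ A.X).hom ≫ pS) := MorphismProperty.comp_mem _ _ _ hAA inferInstance
  haveI : IsReduced (A.X ⊗ A.X).left :=
    Literature.AlgebraicGeometry.Resolution.isReduced_of_smooth ((A.X ⊗ A.X).hom ≫ pS)
  exact A.isCommMonObj_of_isReduced pS

/-- Over a FIELD `K` itself (`S = Spec K`, `pS = 𝟙`): every abelian scheme over `Spec K` is commutative — recovers ★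
`AbelianVariety.instIsCommMonObj` through the general statement (sanity check of the hypotheses).
[cite: MumfordFogartyKirwan1994, Ch. 6 §1 Corollary 6.5 (p. 117)] -/
theorem isCommMonObj_of_field {K : Type u} [Field K] (A : AbelianSchemeOver (Spec (.of K))) : IsCommMonObj A.X :=
  A.isCommMonObj_of_smooth (𝟙 _)

end AbelianSchemeOver

end Literature.AlgebraicGeometry.AbelianSchemes

end
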